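import Literature.NumberTheory.LFunctions.Lagarias1999.Bounds
import Mathlib.Tactic.NormNum.LegendreSymbol
import Mathlib.Tactic.NormNum.Prime
import HarnessLib

/-!
# Lagarias (1999), Acta Arith. 89, pp. 220–221 — the question answered in the negative

> "To summarize: Theorem 1.2 holds for all algebraic number fields, while a generalization of
> Theorem 1.3 fails for some algebraic number fields. Could it be the case that for all algebraic
> number fields K the infimum of Re(ξ_K'(s)/ξ_K(s)) is attained on the real axis outside the
> critical strip, i.e. for σ > 1?" [LagariasXiPositivity1999, pp. 220–221]

**No** (`not_question`): for `K = ℚ(√−163)` (`r₁ = 0`, `r₂ = 1`, every prime `< 41` inert) and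
`σ = 2`, `t = 7/4`,
`ξ_K'/ξ_K(2) − Re ξ_K'/ξ_K(2 + 7i/4) ≥ (3/2 − 32/113 − 16/65) − 0.41131 − 2(0.2009 + 2·7.9078/1000) > 0.1`,
so `inf_t Re ξ_K'/ξ_K(2+it) < ξ_K'/ξ_K(2)` and the infimum is not attained at `t = 0`
(`exists_not_infAttainedOnRealAxis`, `exists_re_logDeriv_xi_lt`). The three decimal bounds are
the kernel certificate `Lagarias1999.cert163_true`; this file proves its soundness
(`cert163_sound`) and assembles the inequality of `Lagarias1999.Bounds`.
(For `K = ℚ` the answer is yes for `σ > 10` by the paper's Theorem 1.3; numerically the failure for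
`ℚ(√−163)` at `σ = 2` has size `≈ 0.335`.)
-/

open Complex NumberField
open scoped LSeries.notation ArithmeticFunction.vonMangoldt NumberTheorySymbols
open Literature.NumberTheory.QuadraticFields Literature.NumberTheory.QuadraticFields.Quadratic
open Literature.Analysis.ValidatedNumerics Literature.Analysis.ValidatedNumerics.NumericsMP

namespace Literature.NumberTheory.LFunctions.Lagarias1999

/-! ## Soundness -/

/-- [folklore] -/
private theorem SC_pos : 0 < SC := by unfold SC; positivity

/-- `(p/163) = −1` for the twelve primes `p < 41` (Euler–Rabinowitsch). [folklore] -/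
private theorem jacobiSym_eq_neg_one_of_isInert {n : ℕ} (h : isInert n = true) : J((n : ℤ) | 163) = -1 := by
  simp only [isInert, Bool.or_eq_true, beq_iff_eq] at h
  rcases h with ((((((((((rfl | rfl) | rfl) | rfl) | rfl) | rfl) | rfl) | rfl) | rfl) | rfl) | rfl) | rfl
    <;> norm_num [jacobiSym]

/-- `Λ(n) ≤ log d` for any divisor `d ≥ 2` of `n`. [folklore] -/
private theorem vonMangoldt_le_log_of_dvd {n d : ℕ} (hd : 2 ≤ d) (hdn : d ∣ n) : Λ n ≤ Real.log d := by
  rw [ArithmeticFunction.vonMangoldt_apply]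
  have hmf : (n.minFac : ℝ) ≤ d := by exact_mod_cast Nat.minFac_le_of_dvd hd hdn
  have hmf1 : (1 : ℝ) ≤ n.minFac := by exact_mod_cast Nat.minFac_pos n
  split_ifs
  · exact Real.log_le_log (by linarith) hmf
  · exact Real.log_nonneg (by linarith)

/-- A product of two coprime numbers `> 1` is not a prime power, so `Λ = 0` there. [folklore] -/
private theorem vonMangoldt_eq_zero_of_coprime_mul {a b : ℕ} (ha : 1 < a) (hb : 1 < b)
    (hab : Nat.Coprime a b) : Λ (a * b) = 0 := by
  rw [ArithmeticFunction.vonMangoldt_eq_zero_iff]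
  intro hp
  rcases (hab.isPrimePow_dvd_mul hp).mp dvd_rfl with h | h
  · have := Nat.le_of_dvd (by omega) h
    have : a * 2 ≤ a * b := Nat.mul_le_mul_left a hb
    omega
  · have := Nat.le_of_dvd (by omega) h
    have : 2 * b ≤ a * b := Nat.mul_le_mul_right b ha
    omega

/-- Soundness of `termHiCore`. [folklore] -/
private theorem termHiCore_sound {n d m q : ℕ} {h : ℤ} (hn2 : 2 ≤ n) (hh : termHiCore n d m q = some h) :
    lambdaK 163 n / (n : ℝ) ^ 2 * SC ≤ h := by
  unfold termHiCore at hh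
  split_ifs at hh with hsplit hdiv
  · cases hh
    obtain ⟨hqm, hq1, hm1, hcop⟩ := hsplit
    have hΛ : Λ n = 0 := by
      rw [← hqm]; exact vonMangoldt_eq_zero_of_coprime_mul hq1 hm1 hcop
    simp [lambdaK, hΛ]
  · split at hh
    · rename_i lg hL
      cases hh
      obtain ⟨hmod, hd2⟩ := hdiv
      have hdvd : d ∣ n := Nat.dvd_of_mod_eq_zero hmod
      have hlog := (MI.mem_logNat SC_pos hL).2
      have hn : (0 : ℝ) < (n : ℝ) ^ 2 := by positivity
      have hΛ : lambdaK 163 n ≤ 2 * Real.log d :=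
        (lambdaK_le 163 n).trans (mul_le_mul_of_nonneg_left (vonMangoldt_le_log_of_dvd hd2 hdvd)
          (by norm_num))
      have hnn : (0 : ℤ) < ((n * n : ℕ) : ℤ) := by positivity
      refine le_trans ?_ (Numerics.div_le_cdiv (a := 2 * lg.hi) hnn)
      rw [le_div_iff₀ (by exact_mod_cast hnn)]
      push_cast
      have : lambdaK 163 n / (n : ℝ) ^ 2 * SC * ((n : ℝ) * n) = lambdaK 163 n * SC := by
        field_simp
      rw [this]
      have hS : (0 : ℝ) ≤ SC := by positivity
      nlinarith [mul_le_mul_of_nonneg_right hΛ hS]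
    · cases hh

/-- Soundness of `termHi`. [folklore] -/
private theorem termHi_sound {n : ℕ} {h : ℤ} (hh : termHi n = some h) :
    lambdaK 163 n / (n : ℝ) ^ 2 * SC ≤ h := by
  unfold termHi at hh
  split_ifs at hh with h2 hin
  · -- `n < 2`: `Λ(0) = Λ(1) = 0`
    cases hh
    interval_cases n <;> simp [lambdaK, ArithmeticFunction.vonMangoldt_apply_one]
  · cases hh
    simp [lambdaK, jacobiSym_eq_neg_one_of_isInert hin]
  · exact termHiCore_sound (by omega) hh

/-- Soundness of `sumHi`. [folklore] -/
private theorem sumHi_sound : ∀ (N : ℕ) {T : ℤ}, sumHi N = some T →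
    (∑ n ∈ Finset.range N, lambdaK 163 n / (n : ℝ) ^ 2) * SC ≤ T
  | 0, T, h => by simp [sumHi] at h; simp [← h]
  | N + 1, T, h => by
    unfold sumHi at h
    split at h
    · rename_i a b ha hb
      cases h
      rw [Finset.sum_range_succ, add_mul]
      push_cast
      exact add_le_add (sumHi_sound N ha) (termHi_sound hb)
    · cases h

/-- Soundness of `qSumHi`. [folklore] -/
private theorem qSumHi_sound : ∀ M : ℕ,
    (∑ k ∈ Finset.range M, psiDropTerm (7 / 4) k) * SC ≤ qSumHi M
  | 0 => by simp [qSumHi]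
  | M + 1 => by
    rw [Finset.sum_range_succ, add_mul, qSumHi]
    push_cast
    refine add_le_add (qSumHi_sound M) ?_
    have hq : 0 < (M + 2) * (16 * (M + 2) ^ 2 + 49) := by positivity
    have h := (MI.mem_ofFrac SC 16 hq).2
    have e : psiDropTerm (7 / 4) M = ((16 : ℤ) : ℝ) / (((M + 2) * (16 * (M + 2) ^ 2 + 49) : ℕ) : ℝ) := by
      unfold psiDropTerm; push_cast; field_simp; ring
    rw [e]
    exact h

/-- Unscaling: `x·SC ≤ T` and `T·a ≤ b·SC` give `x ≤ b/a`. [folklore] -/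
private theorem le_div_of_scaled {x a b : ℝ} {T : ℤ} (ha : 0 < a) (hx : x * SC ≤ T)
    (hT : (T : ℝ) * a ≤ b * SC) : x ≤ b / a := by
  have hS : (0 : ℝ) < SC := by exact_mod_cast SC_pos
  rw [le_div_iff₀ ha]
  nlinarith [mul_le_mul_of_nonneg_right hx ha.le]

/-- Unscaling of the digamma-drop check. [folklore] -/
private theorem digammaDrop_of_scaled {x : ℝ} {Q : ℤ} (hx : x * SC ≤ Q)
    (h : (49 : ℝ) * (Q * 20604 + SC) * 100000 ≤ 41131 * 16 * 20604 * SC) :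
    (7 / 4 : ℝ) ^ 2 * (x + 1 / (2 * ((((100 : ℕ) : ℝ) + 1) * (((100 : ℕ) : ℝ) + 2)))) ≤
      41131 / 100000 := by
  have hS : (0 : ℝ) < SC := by exact_mod_cast SC_pos
  have h1 : x + 1 / 20604 ≤ ((Q : ℝ) * 20604 + SC) / (20604 * SC) := by
    rw [le_div_iff₀ (by positivity)]
    have : (x + 1 / 20604) * (20604 * SC) = 20604 * (x * SC) + SC := by ring
    rw [this]
    linarith
  have h2 : ((Q : ℝ) * 20604 + SC) / (20604 * SC) ≤ 41131 * 16 / (49 * 100000) := by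
    rw [div_le_div_iff₀ (by positivity) (by norm_num)]
    linarith
  have e1 : (2 * ((((100 : ℕ) : ℝ) + 1) * (((100 : ℕ) : ℝ) + 2))) = 20604 := by norm_num
  have e2 : (7 / 4 : ℝ) ^ 2 = 49 / 16 := by norm_num
  rw [e1, e2]
  calc (49 / 16 : ℝ) * (x + 1 / 20604) ≤ 49 / 16 * (41131 * 16 / (49 * 100000)) := by
        gcongr; exact h1.trans h2
    _ = 41131 / 100000 := by norm_num

/-- **What the certificate proves.** [cite: LagariasXiPositivity1999, pp. 220–221] -/
theorem cert163_sound (h : cert163 = true) :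
    (∑ n ∈ Finset.range 1001, lambdaK 163 n / (n : ℝ) ^ 2 ≤ 2009 / 10000) ∧
    (Real.log 1000 ≤ 69078 / 10000) ∧
    ((7 / 4 : ℝ) ^ 2 * (∑ k ∈ Finset.range 100, psiDropTerm (7 / 4) k +
        1 / (2 * ((((100 : ℕ) : ℝ) + 1) * (((100 : ℕ) : ℝ) + 2)))) ≤ 41131 / 100000) := by
  unfold cert163 at h
  split at h
  · rename_i T lg hT hL
    simp only [Bool.and_eq_true, decide_eq_true_eq] at h
    obtain ⟨⟨h1, h2⟩, h3⟩ := h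
    have h1' : (T : ℝ) * 10000 ≤ 2009 * SC := by exact_mod_cast h1
    have h2' : (lg.hi : ℝ) * 10000 ≤ 69078 * SC := by exact_mod_cast h2
    have h3' : (49 : ℝ) * (qSumHi 100 * 20604 + SC) * 100000 ≤ 41131 * 16 * 20604 * SC := by
      exact_mod_cast h3
    refine ⟨le_div_of_scaled (by norm_num) (sumHi_sound 1001 hT) h1', ?_,
      digammaDrop_of_scaled (qSumHi_sound 100) h3'⟩
    have hlog := (MI.mem_logNat SC_pos hL).2
    have e : (((1000 : ℕ) : ℝ)) = 1000 := by norm_num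
    rw [e] at hlog
    exact le_div_of_scaled (by norm_num) hlog h2'
  · exact absurd h Bool.false_ne_true

/-- `Re (1/(a+bi)) = a/(a²+b²)`. [folklore] -/
private theorem re_one_div_add_mul_I (a b : ℝ) : (1 / (a + b * I : ℂ)).re = a / (a ^ 2 + b ^ 2) := by
  have hz : (a + b * I : ℂ) = ⟨a, b⟩ := by apply Complex.ext <;> simp
  rw [hz, one_div, Complex.inv_re, Complex.normSq_mk]
  simp [sq]

/-- **The counterexample.** For the imaginary quadratic field `K = ℚ(√−163)` (`d_K = −163`) and
`σ = 2 > 1`, `t = 7/4`: `Re ξ_K'/ξ_K(2 + 7i/4) < ξ_K'/ξ_K(2)`, so `h_K(2) = inf_t Re ξ_K'/ξ_K(2+it)`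
is NOT attained on the real axis. Quantitatively (cosine-free bound, kernel certificate `cert163`)
`ξ_K'/ξ_K(2) − Re ξ_K'/ξ_K(2+7i/4) ≥ (3/2 − 32/113 − 16/65) − 0.41131 − 2·(0.2009 + 2·7.9078/1000) > 1/10`.
[cite: LagariasXiPositivity1999, pp. 220–221] -/
theorem exists_not_infAttainedOnRealAxis :
    ∃ (K : Type) (_ : Field K) (_ : NumberField K),
      NumberField.discr K = -163 ∧ ¬ InfAttainedOnRealAxis K 2 := by
  have hp : Nat.Prime 163 := by norm_num
  have hsq : Squarefree (-163 : ℤ) := by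
    rw [← Int.squarefree_natAbs]
    exact hp.prime.squarefree
  obtain ⟨K, _, _, h2, hd⟩ :=
    exists_numberField_discr_eq (D := -163) (Or.inl ⟨by norm_num, hsq, by norm_num⟩)
  refine ⟨K, inferInstance, inferInstance, hd, fun hA => ?_⟩
  have hdneg : NumberField.discr K < 0 := by rw [hd]; norm_num
  have hodd : Odd (NumberField.discr K) := by rw [hd]; decide
  have hq : (NumberField.discr K).natAbs = 163 := by rw [hd]; rfl
  haveI : NeZero (NumberField.discr K).natAbs := ⟨by rw [hq]; norm_num⟩
  -- the question's inequality at `t = 7/4`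
  have hQ := hA (7 / 4)
  simp only [Complex.ofReal_ofNat] at hQ
  -- the main inequality and the three certified bounds
  have hmain := re_logDeriv_xi_two_sub_ge h2 hdneg hodd (7 / 4 : ℝ)
  have hψ := re_digamma_sub_le (7 / 4 : ℝ) 100
  have hS := tsum_lambdaK_div_sq_le (q := (NumberField.discr K).natAbs) (N := 1001) (by norm_num)
  rw [hq] at hmain hS
  obtain ⟨c1, c2, c3⟩ := cert163_sound cert163_true
  have ha : (1 / (2 + ((7 / 4 : ℝ) : ℂ) * I)).re = 32 / 113 := by
    rw [show (2 : ℂ) = ((2 : ℝ) : ℂ) by norm_num, re_one_div_add_mul_I]; norm_num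
  have hb : (1 / (1 + ((7 / 4 : ℝ) : ℂ) * I)).re = 16 / 65 := by
    rw [show (1 : ℂ) + ((7 / 4 : ℝ) : ℂ) * I = ((1 : ℝ) : ℂ) + ((7 / 4 : ℝ) : ℂ) * I by norm_num,
      re_one_div_add_mul_I]; norm_num
  have e1 : ((1001 : ℕ) : ℝ) - 1 = 1000 := by norm_num
  rw [ha, hb] at hmain
  rw [e1] at hS
  -- hide the big sums from the arithmetic tactics
  generalize (∑ n ∈ Finset.range 1001, lambdaK 163 n / (n : ℝ) ^ 2) = S₁ at hS c1
  generalize (∑' n : ℕ, lambdaK 163 n / (n : ℝ) ^ 2) = S₂ at hmain hS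
  generalize (∑ k ∈ Finset.range 100, psiDropTerm (7 / 4) k) = S₃ at hψ c3
  linarith

/-- **Answer to the question of [LagariasXiPositivity1999, pp. 220–221]: no.** It is not the case
that for every number field `K` and every `σ > 1` the infimum of `Re ξ_K'/ξ_K(σ+it)` over `t` is
attained at `t = 0`: it fails for `K = ℚ(√−163)`, `σ = 2`. [cite: LagariasXiPositivity1999, pp. 220–221] -/
theorem not_question : ¬ Question := by
  intro hQ
  obtain ⟨K, _, _, _, hK⟩ := exists_not_infAttainedOnRealAxis
  exact hK (hQ K 2 (by norm_num))

/-- Equivalently: for `K = ℚ(√−163)`, `h_K(2) < ξ_K'/ξ_K(2)` is witnessed by `t = 7/4`, i.e. some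
`t` has `Re ξ_K'/ξ_K(2+it) < ξ_K'/ξ_K(2)`. [cite: LagariasXiPositivity1999, pp. 220–221] -/
theorem exists_re_logDeriv_xi_lt :
    ∃ (K : Type) (_ : Field K) (_ : NumberField K) (t : ℝ),
      NumberField.discr K = -163 ∧
        (logDeriv (xi K) ((2 : ℂ) + t * I)).re < (logDeriv (xi K) (2 : ℂ)).re := by
  obtain ⟨K, _, _, hd, hK⟩ := exists_not_infAttainedOnRealAxis
  simp only [InfAttainedOnRealAxis, not_forall, not_le, Complex.ofReal_ofNat] at hK
  obtain ⟨t, ht⟩ := hK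
  exact ⟨K, inferInstance, inferInstance, t, hd, ht⟩

end Literature.NumberTheory.LFunctions.Lagarias1999
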